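import Summits.CriticalPhenomena.PercolationContinuityZ3.Theorems.PercNearOneGluingNoHeavyQuantFarTwoHubTransfer
import Summits.CriticalPhenomena.PercolationContinuityZ3.Theorems.PercNearOneGluingNoHeavyQuantFarLayerOneUnicyclicAll
import Summits.CriticalPhenomena.PercolationContinuityZ3.Theorems.PercNearOneGluingNoHeavyQuantFarBlockUnloaded
import HarnessLib

/-!
# QUANT lane R8, front "FAR beyond trees", layer one — CACTI OF TWO-HUB BLOCKS (any depth): FAR at layer one, unconditionally

builds on p205010 (kernel theorem, internal audit signed; external expert review pending)

Support file (`--supports stmt-CriticalPhenomena-4575`), seat `prim-quant-p1` (gen 19); memo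
`run/shared/lean/prim/quant/prim-quant-p1-g19/FOR-LEAD-CACTI.md` §5 (the cactus assembly).  Standard axioms; no sorries.

A list of two-hub blocks (`Block.HDatum`: cut vertex `c`, anchors `v₁ v₂`, block `Z`, hubs `S₁ S₂` = whatever hangs at the anchors, e.g. deeper
sub-cacti) is decoupled head first (`Block.hdecoupleAll`); decoupling one block keeps every later block well formed as soon as the two are
COMPATIBLE (`Block.HDatum.Compat`: the earlier block lies outside the later one, or inside one of its hubs) — the nesting pattern of a cactus
processed deepest-block-first OR root-first; a block carrying no relay is simply re-weighted (`Block.farLayerOne_unloaded`).  Hence: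

* **`Block.farLayerOne_of_blocks`** — decoupling a compatible list of blocks transfers the `j = 1` FAR instance from the fully decoupled weights
  to `w` (any observer off the blocks, any base theorem);
* **`Block.layerOne_of_pforest_cactus`** (observer on the root cycle), `Block.layerOne_of_pforest_cactus_treeObs` (observer in a pendant tree) —
  with the unicyclic base: if the fully hub-decoupled weights form a pendant forest on a cycle (`Bundle.PForest`) carrying the relays, then for
  the ORIGINAL weights `2 < Σ_a P_w(o ↔ a)` and `P_w(o ↮ a) ≤ t` on `A` imply `P_w(#{a ∈ A : o ↔ a} ≤ 1) ≤ t`.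
In particular FAR holds at layer one on every cactus all of whose blocks not containing the observer are loaded at ≤ 2 vertices (every
TRIANGLE CACTUS), presented this way: each step is `Block.farLayerOne_twoHub`, the base is `Bundle.layerOne_of_pforest_cycleObs` (p1 g18 +
prim-cert-1 g23, all-K `SunFAR`).  [cite: KozmaNitzan2024, Conjecture 3 (p. 15)] (the row); [this work].
-/

noncomputable section

namespace Summit.CriticalPhenomena.PercolationContinuityZ3.Theorems

namespace Quant

namespace Block

open Finset MeasureTheory Set
open Literature.Probability.LatticeModels
open Literature.Probability.Percolation
open Bundle (avoid)
open scoped Classical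

variable {n : ℕ}

/-- The data of a pendant two-hub block: cut vertex `c`, anchors `v₁, v₂`, block `Z`, hubs `S₁, S₂`. [this work] -/
structure HDatum (n : ℕ) where
  /-- the cut vertex -/
  c : Fin n
  /-- first anchor -/
  v₁ : Fin n
  /-- second anchor -/
  v₂ : Fin n
  /-- the block's vertices (without `c`) -/
  Z : Finset (Fin n)
  /-- what hangs at `v₁` -/
  S₁ : Finset (Fin n)
  /-- what hangs at `v₂` -/
  S₂ : Finset (Fin n)

namespace HDatum

/-- Well-formedness of a two-hub block w.r.t. weights `w`, relays `A`, observer `o` (the block may carry no relay at all). [this work] -/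
structure OK (B : HDatum n) (w : Sym2 (Fin n) → unitInterval) (A : Finset (Fin n)) (o : Fin n) : Prop where
  two : IsTwoHub B.c B.v₁ B.v₂ B.Z B.S₁ B.S₂
  obs : o ∉ B.Z
  hangZ : ∀ x y : Fin n, x ≠ y → x ∈ B.Z → y ∉ B.Z → y ≠ B.c → (w s(x, y) : ℝ) = 0
  hangS₁ : ∀ x y : Fin n, x ≠ y → x ∈ B.S₁ → y ∉ B.S₁ → y ≠ B.v₁ → (w s(x, y) : ℝ) = 0
  hangS₂ : ∀ x y : Fin n, x ≠ y → x ∈ B.S₂ → y ∉ B.S₂ → y ≠ B.v₂ → (w s(x, y) : ℝ) = 0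
  rel : A ∩ B.Z ⊆ B.S₁ ∪ B.S₂ ∪ {B.v₁, B.v₂}

/-- The hub-decoupled weights of one block. [this work] -/
def dec (B : HDatum n) (w : Sym2 (Fin n) → unitInterval) : Sym2 (Fin n) → unitInterval := hdecouple B.c B.v₁ B.v₂ B.Z B.S₁ B.S₂ w

/-- COMPATIBILITY of an earlier block `B` with a later block `B'`: the stems of `B` (`s(c_B, vᵢ^B)`) are not pairs that `B'` needs to vanish —
`B` lies outside `B'` (its cut vertex and anchors are off `Z'`), or `B` sits inside one of the hubs of `B'`. [this work] -/
def Compat (B B' : HDatum n) : Prop :=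
  (B.c ∉ B'.Z ∧ B.v₁ ∉ B'.Z ∧ B.v₂ ∉ B'.Z) ∨
  ((B.c ∈ B'.S₁ ∨ B.c = B'.v₁) ∧ B.Z ⊆ B'.S₁) ∨
  ((B.c ∈ B'.S₂ ∨ B.c = B'.v₂) ∧ B.Z ⊆ B'.S₂)

/-- The stems of a compatible earlier block are not forbidden pairs of the later block. [this work] -/
theorem Compat.stem_ok {B B' : HDatum n} (hc : Compat B B') (hB : IsTwoHub B.c B.v₁ B.v₂ B.Z B.S₁ B.S₂)
    (hB' : IsTwoHub B'.c B'.v₁ B'.v₂ B'.Z B'.S₁ B'.S₂) {v : Fin n} (hv : v = B.v₁ ∨ v = B.v₂) {x y : Fin n}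
    (hxy : s(x, y) = s(B.c, v)) :
    ¬ (x ∈ B'.Z ∧ y ∉ B'.Z ∧ y ≠ B'.c) ∧ ¬ (x ∈ B'.S₁ ∧ y ∉ B'.S₁ ∧ y ≠ B'.v₁) ∧ ¬ (x ∈ B'.S₂ ∧ y ∉ B'.S₂ ∧ y ≠ B'.v₂) := by
  have hvZ : v ∈ B.Z := by rcases hv with rfl | rfl; exacts [hB.v₁Z, hB.v₂Z]
  -- `{x, y} = {c_B, v}`
  have hxy' : (x = B.c ∧ y = v) ∨ (x = v ∧ y = B.c) := Sym2.eq_iff.1 hxy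
  rcases hc with ⟨hcZ, h1, h2⟩ | ⟨hcS, hZS⟩ | ⟨hcS, hZS⟩
  · -- `B` outside `B'`
    have hvZ' : v ∉ B'.Z := by rcases hv with rfl | rfl; exacts [h1, h2]
    have hx : x ∉ B'.Z := by rcases hxy' with ⟨rfl, -⟩ | ⟨rfl, -⟩; exacts [hcZ, hvZ']
    exact ⟨fun h => hx h.1, fun h => hx (hB'.S₁Z h.1), fun h => hx (hB'.S₂Z h.1)⟩
  · -- `B` inside the first hub of `B'`
    have hvS : v ∈ B'.S₁ := hZS hvZ
    have hyin : y ∈ B'.S₁ ∨ y = B'.v₁ := by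
      rcases hxy' with ⟨-, rfl⟩ | ⟨-, rfl⟩
      · exact Or.inl hvS
      · exact hcS
    have hxin : x ∈ B'.S₁ ∨ x = B'.v₁ := by
      rcases hxy' with ⟨rfl, -⟩ | ⟨rfl, -⟩
      · exact hcS
      · exact Or.inl hvS
    refine ⟨fun h => ?_, fun h => ?_, fun h => ?_⟩
    · rcases hyin with hy | hy
      · exact h.2.1 (hB'.S₁Z hy)
      · exact h.2.1 (hy ▸ hB'.v₁Z)
    · rcases hyin with hy | hy
      · exact h.2.1 hy
      · exact h.2.2 hy
    · rcases hxin with hx | hx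
      · exact Finset.disjoint_left.1 hB'.disj hx h.1
      · exact hB'.v₁S₂ (hx ▸ h.1)
  · -- `B` inside the second hub of `B'`
    have hvS : v ∈ B'.S₂ := hZS hvZ
    have hyin : y ∈ B'.S₂ ∨ y = B'.v₂ := by
      rcases hxy' with ⟨-, rfl⟩ | ⟨-, rfl⟩
      · exact Or.inl hvS
      · exact hcS
    have hxin : x ∈ B'.S₂ ∨ x = B'.v₂ := by
      rcases hxy' with ⟨rfl, -⟩ | ⟨rfl, -⟩
      · exact hcS
      · exact Or.inl hvS
    refine ⟨fun h => ?_, fun h => ?_, fun h => ?_⟩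
    · rcases hyin with hy | hy
      · exact h.2.1 (hB'.S₂Z hy)
      · exact h.2.1 (hy ▸ hB'.v₂Z)
    · rcases hxin with hx | hx
      · exact Finset.disjoint_left.1 hB'.disj h.1 hx
      · exact hB'.v₂S₁ (hx ▸ h.1)
    · rcases hyin with hy | hy
      · exact h.2.1 hy
      · exact h.2.2 hy

/-- **Decoupling a compatible earlier block keeps a later block well formed.** [this work] -/
theorem ok_dec_of_compat {B B' : HDatum n} {w : Sym2 (Fin n) → unitInterval} {A : Finset (Fin n)} {o : Fin n}
    (hB : IsTwoHub B.c B.v₁ B.v₂ B.Z B.S₁ B.S₂) (hB' : B'.OK w A o) (hc : Compat B B') : B'.OK (B.dec w) A o := by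
  -- the decoupled weight of a pair that `w` kills and that is not a stem of `B` is `0`
  have key : ∀ x y : Fin n, (w s(x, y) : ℝ) = 0 →
      ((x ∈ B'.Z ∧ y ∉ B'.Z ∧ y ≠ B'.c) ∨ (x ∈ B'.S₁ ∧ y ∉ B'.S₁ ∧ y ≠ B'.v₁) ∨ (x ∈ B'.S₂ ∧ y ∉ B'.S₂ ∧ y ≠ B'.v₂)) →
      (B.dec w s(x, y) : ℝ) = 0 := by
    intro x y hw0 hforb
    by_cases hav : s(x, y) ∈ avoid B.Z
    · rw [HDatum.dec, hdecouple_of_avoid w hav]; exact hw0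
    · by_cases h1 : s(x, y) = s(B.c, B.v₁)
      · obtain ⟨n1, n2, n3⟩ := hc.stem_ok hB hB'.two (Or.inl rfl) h1
        exact absurd hforb (by rintro (h | h | h); exacts [n1 h, n2 h, n3 h])
      · by_cases h2 : s(x, y) = s(B.c, B.v₂)
        · obtain ⟨n1, n2, n3⟩ := hc.stem_ok hB hB'.two (Or.inr rfl) h2
          exact absurd hforb (by rintro (h | h | h); exacts [n1 h, n2 h, n3 h])
        · by_cases h3 : s(x, y) ∈ hubPairs B.S₁ B.v₁ ∨ s(x, y) ∈ hubPairs B.S₂ B.v₂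
          · rw [HDatum.dec, hdecouple_hub hB w h3]; exact hw0
          · exact hdecouple_zero w hav h1 h2 h3
  refine ⟨hB'.two, hB'.obs, ?_, ?_, ?_, hB'.rel⟩
  · intro x y hxy hx hy hyc
    exact key x y (hB'.hangZ x y hxy hx hy hyc) (Or.inl ⟨hx, hy, hyc⟩)
  · intro x y hxy hx hy hyv
    exact key x y (hB'.hangS₁ x y hxy hx hy hyv) (Or.inr (Or.inl ⟨hx, hy, hyv⟩))
  · intro x y hxy hx hy hyv
    exact key x y (hB'.hangS₂ x y hxy hx hy hyv) (Or.inr (Or.inr ⟨hx, hy, hyv⟩))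

end HDatum

/-- Hub-decouple a list of blocks in turn (head first). [this work] -/
def hdecoupleAll : List (HDatum n) → (Sym2 (Fin n) → unitInterval) → (Sym2 (Fin n) → unitInterval)
  | [], w => w
  | B :: rest, w => hdecoupleAll rest (B.dec w)

/-- **Decoupling a compatible list of two-hub blocks transfers the layer-one FAR instance** (any observer off all blocks): if the blocks are
well formed for `w`, pairwise compatible in list order, and the `j = 1` FAR instance at `(A, o, t)` holds for the fully hub-decoupled weights,
then it holds for `w`. [this work] -/
theorem farLayerOne_of_blocks (A : Finset (Fin n)) (o : Fin n) (t : ℝ) :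
    ∀ (blocks : List (HDatum n)) (w : Sym2 (Fin n) → unitInterval),
      (∀ B ∈ blocks, B.OK w A o) →
      blocks.Pairwise HDatum.Compat →
      ((2 : ℝ) < ∑ a ∈ A, (prodBernoulli (hdecoupleAll blocks w)).real (openConn o a) →
        (∀ a ∈ A, (prodBernoulli (hdecoupleAll blocks w)).real (openConn o a : Set (BondConfig (Fin n)))ᶜ ≤ t) →
        (prodBernoulli (hdecoupleAll blocks w)).real {ω : BondConfig (Fin n) | (A.filter fun a => ω ∈ openConn o a).card ≤ 1} ≤ t) →
      (2 : ℝ) < ∑ a ∈ A, (prodBernoulli w).real (openConn o a) →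
      (∀ a ∈ A, (prodBernoulli w).real (openConn o a : Set (BondConfig (Fin n)))ᶜ ≤ t) →
      (prodBernoulli w).real {ω : BondConfig (Fin n) | (A.filter fun a => ω ∈ openConn o a).card ≤ 1} ≤ t := by
  intro blocks
  induction blocks with
  | nil =>
    intro w _ _ hbase hEN hcut
    exact hbase hEN hcut
  | cons B rest ih =>
    intro w hOK hpw hbase hEN hcut
    have hB : B.OK w A o := hOK B (by simp)
    rw [List.pairwise_cons] at hpw
    obtain ⟨hBrest, hrest⟩ := hpw
    have hOK' : ∀ B' ∈ rest, B'.OK (B.dec w) A o := fun B' hB' =>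
      HDatum.ok_dec_of_compat hB.two (hOK B' (List.mem_cons_of_mem _ hB')) (hBrest B' hB')
    by_cases hl : (A ∩ B.Z).Nonempty
    · exact farLayerOne_twoHub hB.two w hB.obs hB.hangZ hB.hangS₁ hB.hangS₂ A hB.rel hl t
        (fun hEN' hcut' => ih (B.dec w) hOK' hrest hbase hEN' hcut') hEN hcut
    · -- a relay-free block: re-weighting it changes nothing
      exact farLayerOne_unloaded w (B.dec w) hB.obs hB.hangZ (hdecouple_block_vanish hB.two w)
        (fun e he => (hdecouple_of_avoid w he).symm) A (fun a ha haZ => hl ⟨a, Finset.mem_inter.2 ⟨ha, haZ⟩⟩) t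
        (fun hEN' hcut' => ih (B.dec w) hOK' hrest hbase hEN' hcut') hEN hcut

variable {Lc : ℕ} {cyc : ℕ → Fin n} {idx : Fin n → ℕ} {T : Finset (Fin n)} {par' : Fin n → Fin n} {dep : Fin n → ℕ}

/-- **FAR at layer one on cacti of two-hub blocks, observer on the root cycle.**  The blocks are well formed for `w`, pairwise compatible in
list order, and the fully hub-decoupled weights form a pendant forest on a cycle carrying the relays; then for the ORIGINAL weights:
`2 < Σ_{a∈A} P_w(c₀ ↔ a)` and `P_w(c₀ ↮ a) ≤ t` on `A` imply `P_w(#{a ∈ A : c₀ ↔ a} ≤ 1) ≤ t`. [this work] -/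
theorem layerOne_of_pforest_cactus (A : Finset (Fin n)) (t : ℝ) (hA' : ∀ a ∈ A, a ∈ T ∨ ∃ i, i < Lc ∧ a = cyc i)
    (blocks : List (HDatum n)) (w : Sym2 (Fin n) → unitInterval) (hOK : ∀ B ∈ blocks, B.OK w A (cyc 0))
    (hcompat : blocks.Pairwise HDatum.Compat) (P : Bundle.PForest Lc cyc idx T par' dep (hdecoupleAll blocks w))
    (hEN : (2 : ℝ) < ∑ a ∈ A, (prodBernoulli w).real (openConn (cyc 0) a))
    (hcut : ∀ a ∈ A, (prodBernoulli w).real (openConn (cyc 0) a : Set (BondConfig (Fin n)))ᶜ ≤ t) :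
    (prodBernoulli w).real {ω : BondConfig (Fin n) | (A.filter fun a => ω ∈ openConn (cyc 0) a).card ≤ 1} ≤ t :=
  farLayerOne_of_blocks A (cyc 0) t blocks w hOK hcompat
    (fun hEN' hcut' => Bundle.layerOne_of_pforest_cycleObs P A hA' t hEN' hcut') hEN hcut

/-- **The same with the observer in a pendant tree of the final presentation** (`par'^[k+1] o = c₀`, chain in `T`, `o` off every block).
[this work] -/
theorem layerOne_of_pforest_cactus_treeObs (A : Finset (Fin n)) (t : ℝ) (hA' : ∀ a ∈ A, a ∈ T ∨ ∃ i, i < Lc ∧ a = cyc i)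
    (blocks : List (HDatum n)) (w : Sym2 (Fin n) → unitInterval) {o : Fin n} (hOK : ∀ B ∈ blocks, B.OK w A o)
    (hcompat : blocks.Pairwise HDatum.Compat) (P : Bundle.PForest Lc cyc idx T par' dep (hdecoupleAll blocks w))
    {k : ℕ} (hk : par'^[k + 1] o = cyc 0) (hchain : ∀ j, j ≤ k → par'^[j] o ∈ T)
    (hEN : (2 : ℝ) < ∑ a ∈ A, (prodBernoulli w).real (openConn o a))
    (hcut : ∀ a ∈ A, (prodBernoulli w).real (openConn o a : Set (BondConfig (Fin n)))ᶜ ≤ t) :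
    (prodBernoulli w).real {ω : BondConfig (Fin n) | (A.filter fun a => ω ∈ openConn o a).card ≤ 1} ≤ t :=
  farLayerOne_of_blocks A o t blocks w hOK hcompat
    (fun hEN' hcut' => Bundle.layerOne_of_pforest_treeObs_all P hk hchain A hA' t hEN' hcut') hEN hcut

end Block

end Quant

end Summit.CriticalPhenomena.PercolationContinuityZ3.Theorems
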